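import Summits.CriticalPhenomena.PercolationContinuityZ3.Theorems.PercNearOneGluingNoHeavyLowerTailKnQuestion8CoefficientwiseTwoSourceDomination
import HarnessLib

/-!
# THEOREM A for a source SET: `Σ_{¬(y ∈ K_{x∪Ps} ∧ y ∈ K̄_x)} (g(K_{x∪Ps}) − g(K̄_x)) ≥ 0` — prim-lf-2 gen 53 (part 4)

Support file (`--supports stmt-CriticalPhenomena-4575`, closed), prover `prim-lf-2` (gen 53).  No definitions, no named facts, no sorries; standard axioms.
Memo `prim-lf-2/CW-SERIES-gen53.md` §8; part 1 (`…CoefficientwiseTwoSourceDomination.lean`) is the single-source case.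

Setting as in part 1: finite multigraph `ends : ι → Sym2 V`, root `x`, `K(s) = openCluster (ends '' s) x`; for a SET `Ps` of further sources the red cluster of `{x} ∪ Ps` is
`K(s) ∪ P(s)`, `P(s) = ⋃_{p ∈ Ps} C_p(s)`.
* `multiSource_noCore_domination` — for every `Ps`, `y` and monotone `g`:  `0 ≤ Σ_{s : ¬(y ∈ K s ∪ P s ∧ y ∈ K sᶜ)} (g(K s ∪ P s) − g(K sᶜ))`.
Proof = part 1's (swap pairing), except that the residual `Σ_{E} (g(K sᶜ) − g(K s))`, `E = {y ∉ K s, y ∈ P s, y ∈ K sᶜ}`, is signed by the cells of the red cluster `C_y(s)` of `y`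
ITSELF (`x ∉ C_y s`, `C_y s ∩ Ps ≠ ∅` frozen, `[y ∈ K sᶜ]` antitone): `offCluster_domination_cond` with `p := y`.  Use: for a point `u` adjacent to the root with `N(u) = {x} ∪ Ps`
(any degree), the star class 'all edges at u red' of `NO-CORE(y)[1_u,g]` is exactly this sum on `G − u` (prim-lf-2 code/gen53/c/cmixed.c); the other classes carry an inactive-star bracket
`[P_b ∩ K̄ = ∅]` and are census-nonnegative too (n ≤ 5, all monotone g), so CONJECTURE NO-CORE at every root-adjacent point reduces to those mixed classes.  Exact checks of this
theorem (aset.c): |Ps| = 2, 3 on all graphs with ≤ 5 vertices and on 6 vertices with 4–7 edges (1.07 M instances, min over all monotone g): 0 negatives.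
[cite: KozmaNitzan2024, Questions 8–9 (§5.5 p. 36) (context: the Question-8 pocket covariance programme)]
-/

namespace Summit.CriticalPhenomena.PercolationContinuityZ3.Theorems

open Finset Literature.Probability.Percolation

namespace Coefficientwise

variable {ι V : Type*} [Fintype ι] [DecidableEq ι] (ends : ι → Sym2 V) (x : V)

open Classical in
/-- **THEOREM A for a source SET (prim-lf-2 gen 53): the multi-source exclusion is nonnegative.**  For a finite multigraph, a root `x`, any set `Ps` of further sources, a vertex `y`
and every monotone `g : Set V → ℝ`, with `K(s) = C_x(s)` and `P(s) = ⋃_{p ∈ Ps} C_p(s)`: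
  `0 ≤ Σ_{s : ¬(y ∈ K s ∪ P s ∧ y ∈ K sᶜ)} (g(K s ∪ P s) − g(K sᶜ))`.
After the swap on the blue term the sum is `Σ_s ([b s]·g(K s ∪ P s) − [b sᶜ]·g(K s))`, `b s := ¬(y ∈ K s ∪ P s ∧ y ∈ K sᶜ)`; the colourings with `b s ∧ b sᶜ` contribute
`g(K s ∪ P s) − g(K s) ≥ 0`, the two mixed kinds are exchanged by the swap, and what is left is `Σ_{x ∉ C_y s, C_y s ∩ Ps ≠ ∅, y ∈ K sᶜ} (g(K sᶜ) − g(K s)) ≥ 0` by `offCluster_domination_cond` applied to the red cluster of `y` (not of the sources).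
This is the 'all u-edges red' star class of `NO-CORE(y)[1_u,g]` at a root-adjacent point `u` of ANY degree (`Ps = N(u) ∖ {x}`, on `G − u`); `Ps = {p}` is THEOREM A.  [cite: KozmaNitzan2024, Questions 8–9 (§5.5 p. 36) (context)] -/
theorem multiSource_noCore_domination (Ps : Set V) (y : V) (g : Set V → ℝ) (hg : Monotone g) :
    0 ≤ ∑ s ∈ univ.filter (fun s : Finset ι =>
        ¬ (y ∈ openCluster (ends '' (↑s : Set ι)) x ∪ {v | ∃ p ∈ Ps, v ∈ openCluster (ends '' (↑s : Set ι)) p} ∧ y ∈ openCluster (ends '' (↑(sᶜ) : Set ι)) x)),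
      (g (openCluster (ends '' (↑s : Set ι)) x ∪ {v | ∃ p ∈ Ps, v ∈ openCluster (ends '' (↑s : Set ι)) p}) - g (openCluster (ends '' (↑(sᶜ) : Set ι)) x)) := by
  -- notation
  set K : Finset ι → Set V := fun s => openCluster (ends '' (↑s : Set ι)) x with hK
  set P : Finset ι → Set V := fun s => {v | ∃ p ∈ Ps, v ∈ openCluster (ends '' (↑s : Set ι)) p} with hP
  set Y : Finset ι → Set V := fun s => openCluster (ends '' (↑s : Set ι)) y with hY
  set b : Finset ι → Prop := fun s => ¬ (y ∈ K s ∪ P s ∧ y ∈ K sᶜ) with hb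
  change 0 ≤ ∑ s ∈ univ.filter (fun s : Finset ι => b s), (g (K s ∪ P s) - g (K sᶜ))
  have hKmono : ∀ {s t : Finset ι}, s ⊆ t → K s ⊆ K t := fun hst => openCluster_image_mono ends hst x
  rw [Finset.sum_filter]
  -- (a)+(b): split the summand and swap the blue term
  have hsplit : ∀ s : Finset ι, (if b s then g (K s ∪ P s) - g (K sᶜ) else 0) =
      (if b s then g (K s ∪ P s) else 0) - (if b s then g (K sᶜ) else 0) := by
    intro s; split_ifs <;> simp
  have hswap : ∑ s : Finset ι, (if b s then g (K sᶜ) else 0) = ∑ s : Finset ι, (if b sᶜ then g (K s) else 0) := by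
    rw [← sum_compl_eq (fun s : Finset ι => if b s then g (K sᶜ) else 0)]
    refine Finset.sum_congr rfl fun s _ => ?_
    simp only [compl_compl]
  rw [Finset.sum_congr rfl (fun s _ => hsplit s), Finset.sum_sub_distrib, hswap, ← Finset.sum_sub_distrib]
  -- (c): pointwise lower bound by the two mixed kinds
  have hpt : ∀ s : Finset ι, (if (b s ∧ ¬ b sᶜ) then g (K s ∪ P s) else 0) - (if (¬ b s ∧ b sᶜ) then g (K s) else 0) ≤
      (if b s then g (K s ∪ P s) else 0) - (if b sᶜ then g (K s) else 0) := by
    intro s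
    have hmono : g (K s) ≤ g (K s ∪ P s) := hg Set.subset_union_left
    by_cases h1 : b s
    · by_cases h2 : b sᶜ
      · simp [h1, h2, hmono]
      · simp [h1, h2]
    · by_cases h2 : b sᶜ
      · simp [h1, h2]
      · simp [h1, h2]
  refine le_trans ?_ (Finset.sum_le_sum fun s _ => hpt s)
  rw [Finset.sum_sub_distrib]
  -- (d): the 'good' mixed kind is the swap image of the 'bad' one
  have hgood : ∑ s : Finset ι, (if (b s ∧ ¬ b sᶜ) then g (K s ∪ P s) else 0) =
      ∑ s : Finset ι, (if (¬ b s ∧ b sᶜ) then g (K sᶜ ∪ P sᶜ) else 0) := by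
    rw [← sum_compl_eq (fun s : Finset ι => if (b s ∧ ¬ b sᶜ) then g (K s ∪ P s) else 0)]
    refine Finset.sum_congr rfl fun s _ => ?_
    simp only [compl_compl]
    by_cases h1 : b s <;> by_cases h2 : b sᶜ <;> simp [h1, h2]
  rw [hgood, ← Finset.sum_sub_distrib]
  -- (e): drop the second source on the blue side
  have hpt2 : ∀ s : Finset ι, (if (¬ b s ∧ b sᶜ) then (g (K sᶜ) - g (K s)) else 0) ≤
      (if (¬ b s ∧ b sᶜ) then g (K sᶜ ∪ P sᶜ) else 0) - (if (¬ b s ∧ b sᶜ) then g (K s) else 0) := by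
    intro s
    have hmono : g (K sᶜ) ≤ g (K sᶜ ∪ P sᶜ) := hg Set.subset_union_left
    by_cases h : (¬ b s ∧ b sᶜ)
    · rw [if_pos h, if_pos h, if_pos h]; linarith
    · simp [h]
  refine le_trans ?_ (Finset.sum_le_sum fun s _ => hpt2 s)
  -- (f): identify the 'bad' kind: `¬ b s ∧ b sᶜ ↔ (x ∉ Y s ∧ ∃ p ∈ Ps, p ∈ Y s) ∧ y ∈ K sᶜ` (Y = the red cluster of `y`)
  have hbad : ∀ s : Finset ι, (¬ b s ∧ b sᶜ) ↔ ((x ∉ Y s ∧ ∃ p ∈ Ps, p ∈ Y s) ∧ y ∈ K sᶜ) := by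
    intro s
    simp only [hb, not_not, compl_compl, Set.mem_union]
    constructor
    · rintro ⟨⟨hyR, hyKc⟩, hbc⟩
      have hyK : y ∉ K s := fun hyK => hbc ⟨Or.inl hyKc, hyK⟩
      have hyP : y ∈ P s := by
        rcases hyR with h | h
        · exact absurd h hyK
        · exact h
      obtain ⟨p, hpPs, hyp⟩ := hyP
      refine ⟨⟨fun hxY => hyK (SimpleGraph.Reachable.symm hxY), p, hpPs, SimpleGraph.Reachable.symm hyp⟩, hyKc⟩
    · rintro ⟨⟨hxY, p, hpPs, hpY⟩, hyKc⟩
      refine ⟨⟨Or.inr ⟨p, hpPs, SimpleGraph.Reachable.symm hpY⟩, hyKc⟩, ?_⟩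
      rintro ⟨_, hyK⟩
      exact hxY (SimpleGraph.Reachable.symm hyK)
  -- rewrite as the conditioned one-sided domination sum
  set χ : Finset ι → ℝ := fun s => if y ∈ K sᶜ then (1 : ℝ) else 0 with hχ
  have hχanti : Antitone χ := by
    intro s t hst
    simp only [hχ]
    by_cases ht : y ∈ K tᶜ
    · have hs : y ∈ K sᶜ := hKmono (compl_subset_compl.mpr hst) ht
      simp [ht, hs]
    · simp only [ht, if_false]; split_ifs <;> norm_num
  have hχ0 : ∀ s, 0 ≤ χ s := fun s => by simp only [hχ]; split_ifs <;> norm_num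
  have hosd := offCluster_domination_cond ends x y (fun S : Set V => x ∉ S ∧ ∃ p ∈ Ps, p ∈ S) g hg χ hχanti hχ0
  rw [Finset.sum_filter] at hosd
  have hrw : ∀ s : Finset ι, (if (¬ b s ∧ b sᶜ) then (g (K sᶜ) - g (K s)) else 0) =
      -(if (x ∉ Y s ∧ (x ∉ Y s ∧ ∃ p ∈ Ps, p ∈ Y s)) then χ s * (g (K s) - g (K sᶜ)) else 0) := by
    intro s
    by_cases h : (¬ b s ∧ b sᶜ)
    · obtain ⟨h1, h2⟩ := (hbad s).mp h
      rw [if_pos h, if_pos ⟨h1.1, h1⟩]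
      simp only [hχ, if_pos h2]
      ring
    · rw [if_neg h]
      by_cases h1 : (x ∉ Y s ∧ (x ∉ Y s ∧ ∃ p ∈ Ps, p ∈ Y s))
      · have h2 : y ∉ K sᶜ := fun h2 => h ((hbad s).mpr ⟨h1.2, h2⟩)
        rw [if_pos h1]
        simp only [hχ, if_neg h2]
        ring
      · rw [if_neg h1]
        ring
  rw [Finset.sum_congr rfl (fun s _ => hrw s), Finset.sum_neg_distrib]
  have hosd' : ∑ s : Finset ι, (if (x ∉ Y s ∧ (x ∉ Y s ∧ ∃ p ∈ Ps, p ∈ Y s)) then χ s * (g (K s) - g (K sᶜ)) else 0) ≤ 0 := by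
    convert hosd using 4
  linarith

end Coefficientwise

end Summit.CriticalPhenomena.PercolationContinuityZ3.Theorems
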